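import Summits.BirchSwinnertonDyer.BirchSwinnertonDyer.Theorems.Rank2ObservatoryThreeIsoRow

/-!
# Rank-2 observatory, KERNEL-3ISO (B4-0): the logarithmic index rule `r ≤ a + a' - 1`

HONEST FRAMING: per-curve certified theorems and census instruments; no claim on BSD in rank ≥ 2.

Cell `bsd-rank2-observatory`, cert-1 leg KERNEL-3ISO, generation 10. The row frame
`ThreeIso.mordellWeilRank_le_of_images` (A7) reads the `3`-isogeny index bound
`3^(r+1) ≤ #S · #S'` (`ThreeIso.three_pow_mordellWeilRank_succ_le_of_zsmul`, A1/A3) for finite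
supersets `S ⊇ Im κ`, `S' ⊇ Im κ'` of the two descent images. Both descent maps land in groups of
exponent `3` (`F*/F*³`, `three_nsmul_eq_zero`), so `Im κ`, `Im κ'` are elementary abelian `3`-groups and
their orders are powers of `3` (`IsPGroup.iff_card`): a superset with `#S < 3^(a+1)` therefore certifies
`#Im κ ≤ 3^a` (`exists_finset_card_le_pow`). Feeding the images themselves into A1/A3 gives the
**logarithmic rule** `3^(r+1) ≤ 3^(a+a')`, i.e. `r ≤ a + a' - 1`
(`mordellWeilRank_le_of_images_log`), which is how Cohen GTM 239 Prop. 8.4.6 / Cohen–Pazuki Thm. 1.4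
(`3^{r+1} = #Im α · #Im α̂` for `E_{m,s}`) is used numerically: per row one certifies
`dim Im α ≤ a`, `dim Im α̂ ≤ a'` separately instead of the product `#S · #S' ≤ 80`.

References: [Cohen2007NumberTheoryI] H. Cohen, GTM 239, Prop. 8.4.6; [CohenPazuki2009] H. Cohen,
F. Pazuki, Acta Arith. 140 (2009), Thm. 1.4.
-/

set_option linter.dupNamespace false

noncomputable section

open scoped Classical

open WeierstrassCurve

namespace Summit.BirchSwinnertonDyer.BirchSwinnertonDyer.Rank2Observatory.ThreeIso

open Literature.NumberTheory.EllipticCurves Literature.NumberTheory.EllipticCurves.MordellDescent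

/-- `F*/F*³` (written additively) has exponent `3`. [folklore] -/
theorem three_nsmul_eq_zero {F : Type*} [Field F] (g : Additive (CubeUnits F)) : 3 • g = 0 := by
  have h := CubeUnits.mul_mul_self (Additive.toMul g)
  rw [← pow_two, ← pow_succ] at h
  have := congrArg Additive.ofMul h
  rwa [ofMul_pow, ofMul_toMul, ofMul_one] at this

/-- In a group of exponent `3`, the image of a homomorphism contained in a finite set `S` with
`#S < 3^(a+1)` is a finite set of size `≤ 3^a` (its order is a power of `3`). [folklore] -/
theorem exists_finset_card_le_pow {A G : Type*} [AddCommGroup A] [AddCommGroup G]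
    (hG : ∀ g : G, 3 • g = 0) (κ : A →+ G) (S : Finset G) (hS : ∀ x, κ x ∈ S) (a : ℕ)
    (ha : S.card < 3 ^ (a + 1)) : ∃ S₁ : Finset G, (∀ x, κ x ∈ S₁) ∧ S₁.card ≤ 3 ^ a := by
  have hsub : (κ.range : Set G) ⊆ ↑S := by
    rintro g ⟨x, rfl⟩
    exact hS x
  have hfin : (κ.range : Set G).Finite := S.finite_toSet.subset hsub
  haveI : Finite κ.range := hfin.to_subtype
  haveI : Fact (Nat.Prime 3) := ⟨Nat.prime_three⟩
  -- the range is a `3`-group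
  have hP : IsPGroup 3 (Multiplicative κ.range) := by
    intro g
    refine ⟨1, ?_⟩
    rw [pow_one]
    change Multiplicative.ofAdd (3 • (Multiplicative.toAdd g)) = Multiplicative.ofAdd 0
    congr 1
    apply Subtype.ext
    change ((3 • Multiplicative.toAdd g : κ.range) : G) = 0
    rw [AddSubgroupClass.coe_nsmul]
    exact hG _
  obtain ⟨j, hj⟩ := IsPGroup.iff_card.mp hP
  have hcardR : Nat.card κ.range = 3 ^ j := hj
  refine ⟨hfin.toFinset, fun x => hfin.mem_toFinset.mpr ⟨x, rfl⟩, ?_⟩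
  have hcard : hfin.toFinset.card = 3 ^ j := by
    rw [← hcardR, ← Set.ncard_eq_toFinset_card _ hfin]
    exact (Nat.card_coe_set_eq (κ.range : Set G)).symm
  have hle : hfin.toFinset.card ≤ S.card := Finset.card_le_card (by
    intro g hg
    exact hsub (hfin.mem_toFinset.mp hg))
  rw [hcard] at hle ⊢
  have hlt : 3 ^ j < 3 ^ (a + 1) := lt_of_le_of_lt hle ha
  have := (Nat.pow_lt_pow_iff_right (by norm_num : 1 < 3)).mp hlt
  exact Nat.pow_le_pow_right (by norm_num) (by omega)

/-- **Logarithmic index rule** (A3 read through `exists_finset_card_le_pow`): in the setting of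
`three_pow_mordellWeilRank_succ_le_of_zsmul` with target groups of exponent `3`, finite supersets
`S ⊇ Im κ`, `S' ⊇ Im κ'` with `#S < 3^(a+1)`, `#S' < 3^(a'+1)` give `3^(r+1) ≤ 3^(a+a')`.
[cite: Cohen2007NumberTheoryI, Prop. 8.4.6; CohenPazuki2009, Thm. 1.4] -/
theorem three_pow_mordellWeilRank_succ_le_pow_of_zsmul {K : Type*} [Field K] [NumberField K]
    (W : WeierstrassCurve K) [W.IsElliptic] {B G G' : Type*} [AddCommGroup B] [AddCommGroup G]
    [AddCommGroup G'] (hG : ∀ g : G, 3 • g = 0) (hG' : ∀ g : G', 3 • g = 0)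
    (φ : W.toAffine.Point →+ B) (ψ : B →+ W.toAffine.Point) (n : ℤ) (hn0 : n ≠ 0)
    (h3n : 3 ∣ n) (hψφ : ∀ P, ψ (φ P) = n • P)
    (T : W.toAffine.Point) (hT : 3 • T = 0) (hT0 : T ≠ 0)
    (κ : W.toAffine.Point →+ G) (κ' : B →+ G') (hκ : κ.ker ≤ ψ.range) (hκ' : κ'.ker ≤ φ.range)
    (S : Finset G) (S' : Finset G') (hS : ∀ P, κ P ∈ S) (hS' : ∀ Q, κ' Q ∈ S') (a a' : ℕ)
    (ha : S.card < 3 ^ (a + 1)) (ha' : S'.card < 3 ^ (a' + 1)) :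
    3 ^ (W.mordellWeilRank + 1) ≤ 3 ^ (a + a') := by
  obtain ⟨S₁, hS₁, hc₁⟩ := exists_finset_card_le_pow hG κ S hS a ha
  obtain ⟨S₁', hS₁', hc₁'⟩ := exists_finset_card_le_pow hG' κ' S' hS' a' ha'
  have h := three_pow_mordellWeilRank_succ_le_of_zsmul W φ ψ n hn0 h3n hψφ T hT hT0 κ κ' hκ hκ' S₁ S₁'
    hS₁ hS₁'
  exact h.trans ((Nat.mul_le_mul hc₁ hc₁').trans_eq (pow_add 3 a a').symm)

/-- The logarithmic rule as a rank bound: `#S < 3^(a+1)`, `#S' < 3^(a'+1)`, `a + a' ≤ r₀ + 1` give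
`rank ≤ r₀`. [cite: Cohen2007NumberTheoryI, Prop. 8.4.6] -/
theorem mordellWeilRank_le_of_card_lt_pow_of_zsmul {K : Type*} [Field K] [NumberField K]
    (W : WeierstrassCurve K) [W.IsElliptic] {B G G' : Type*} [AddCommGroup B] [AddCommGroup G]
    [AddCommGroup G'] (hG : ∀ g : G, 3 • g = 0) (hG' : ∀ g : G', 3 • g = 0)
    (φ : W.toAffine.Point →+ B) (ψ : B →+ W.toAffine.Point) (n : ℤ) (hn0 : n ≠ 0)
    (h3n : 3 ∣ n) (hψφ : ∀ P, ψ (φ P) = n • P)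
    (T : W.toAffine.Point) (hT : 3 • T = 0) (hT0 : T ≠ 0)
    (κ : W.toAffine.Point →+ G) (κ' : B →+ G') (hκ : κ.ker ≤ ψ.range) (hκ' : κ'.ker ≤ φ.range)
    (S : Finset G) (S' : Finset G') (hS : ∀ P, κ P ∈ S) (hS' : ∀ Q, κ' Q ∈ S') (a a' r₀ : ℕ)
    (ha : S.card < 3 ^ (a + 1)) (ha' : S'.card < 3 ^ (a' + 1)) (hr : a + a' ≤ r₀ + 1) :
    W.mordellWeilRank ≤ r₀ := by
  have h := three_pow_mordellWeilRank_succ_le_pow_of_zsmul W hG hG' φ ψ n hn0 h3n hψφ T hT hT0 κ κ' hκ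
    hκ' S S' hS hS' a a' ha ha'
  have := (Nat.pow_le_pow_iff_right (by norm_num : 1 < 3)).mp h
  omega

/-- **Row frame, logarithmic form** (replaces the product reading of A7 for generation 10): for
`E = E_{m,s}` with its Vélu data `h`, ANY additive `κ'` on `Ê(ℚ)` into a group of exponent `3` with
`ker κ' ≤ φ(E(ℚ))` and image inside `S'`, `#S' < 3^(a'+1)`, and a finite `S` with `#S < 3^(a+1)`
containing the image of EVERY additive map with the `3`-descent values, give
`rank E(ℚ) ≤ r₀` whenever `a + a' ≤ r₀ + 1`. [cite: Cohen2007NumberTheoryI, Prop. 8.4.6;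
CohenPazuki2009, Thm. 1.4] -/
theorem mordellWeilRank_le_of_images_log [DecidableEq ℚ] {m s : ℚ}
    (h : IsVeluThreePair m s (threeTorsionModel m s) (threeIsogenyCodomain m s))
    {G' : Type*} [AddCommGroup G'] (hG' : ∀ g : G', 3 • g = 0)
    (κ' : (threeIsogenyCodomain m s).toAffine.Point →+ G')
    (hκ' : κ'.ker ≤ h.pointHom.range) (S' : Finset G') (hS' : ∀ Q, κ' Q ∈ S')
    (S : Finset (Additive (CubeUnits ℚ)))
    (hS : ∀ κ : (threeTorsionModel m s).toAffine.Point →+ Additive (CubeUnits ℚ),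
      (∀ (x y : ℚ) (hP : (threeTorsionModel m s).toAffine.Nonsingular x y),
        κ (.some x y hP) =
          Additive.ofMul (cubeClass (if y = m * x + s then (2 * s) ^ 2 else y - (m * x + s)))) →
      ∀ P, κ P ∈ S)
    (a a' r₀ : ℕ) (ha : S.card < 3 ^ (a + 1)) (ha' : S'.card < 3 ^ (a' + 1)) (hr : a + a' ≤ r₀ + 1) :
    (threeTorsionModel m s).mordellWeilRank ≤ r₀ := by
  -- the index lemmas (A1/A3) are elaborated at the classical instance: move everything there
  obtain rfl : ‹DecidableEq ℚ› = fun a b ↦ Classical.propDecidable (a = b) := Subsingleton.elim _ _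
  letI instDecEqRat : DecidableEq ℚ := fun a b ↦ Classical.propDecidable (a = b)
  haveI : (threeTorsionModel m s).IsElliptic := ⟨isUnit_iff_ne_zero.mpr h.Δ_ne⟩
  obtain ⟨ψ, n, κ, hn0, h3n, hψφ, hκ, hκker⟩ := exists_descent_package h
  exact mordellWeilRank_le_of_card_lt_pow_of_zsmul _ three_nsmul_eq_zero hG' h.pointHom ψ n hn0 h3n hψφ
    h.T (three_nsmul_T h) h.T_ne_zero κ κ' hκker hκ' S S' (hS κ hκ) hS' a a' r₀ ha ha' hr

end Summit.BirchSwinnertonDyer.BirchSwinnertonDyer.Rank2Observatory.ThreeIso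

end
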